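import Literature.AlgebraicGeometry.HodgeTheory.WeilClassesFieldQuaternionOverCMFieldDichotomy
import Literature.AlgebraicGeometry.Milne1999.BicommutantFaithful
import Literature.RingTheory.SimpleModule.InvolutionSecondKindMatrixUnits
import HarnessLib

/-!
# Moonen–Zarhin's Criterion (2), THE TYPE-4 ROW FOR EVERY `d` AND `m`: «`W_F` decomposable ⟺ `θ = 0`, all non-zero
# classes exceptional ⟺ `θ ≠ 0`» for `X` with `Z(End⁰(X)) = E = ℚ(ψ)` a CM field — on the carrier and from
# `End(X)`-level data (Moonen–Zarhin 1998 §1, Criterion (2), cases «Type 4, `d = 1`, `m = 1`» and «Type 4 with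
# `d ≥ 2` or `m ≥ 2`»)

Layer `Literature/AlgebraicGeometry/HodgeTheory`; THEOREMS ONLY — no definition, no named fact, no `sorry` (D-0026, net
debt 0).  This closes the seat's type-4 thread: generations 22–24 proved the row for `d = 1`
(`WeilClassesFieldCMCentreDichotomy`, `WeilClassesFieldCMFieldEndLevel`) and `d = 2` (`WeilClassesFieldQuaternionOverCMFieldDichotomy`)
from explicit PRESENTATIONS of `D` (generators adapted to the involution), the missing input for `d ≥ 3` being adjoint-closed
`d × d` matrix units.  Those now come ABSTRACTLY (`RingTheory/SimpleModule/InvolutionSecondKindMatrixUnits`, Milne's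
type-IV normal form `Ē = M_d × M_d`, `(α, β)† = (βᵗʳ, αᵗʳ)`, for any semisimple adjoint-stable algebra of operators whose
centre is «CM»), and the algebra they are applied to is the bicommutant `E'' = End⁰(X) ⊗ ℂ ⊆ End_ℂ H¹(X(ℂ); ℂ)` — semisimple
(`Milne1999.isSemisimpleRing_bicommutant`, Poincaré), adjoint-stable (`Milne1999.rightAdjoint_mem_bicommutant`), faithful
image of `ℂ ⊗_ℚ End⁰(X)` with centre `ℂ[ψ^*]` and free over it (`Milne1999/BicommutantFaithful`).  Consequently NO
PRESENTATION of `D` is needed any more: the End-level theorem below assumes only that THE CENTRE of `End⁰(X)` is the CM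
field `E = ℚ(ψ)` (`ψ` central, `ψ† = ψ' ≠ ψ`, every central `g` has `N g ∈ ℤ[ψ]`) — which is exactly «`X ∼ Y^m` with `Y` of
type 4» for every `d` and `m` (Albert: the centre of `End⁰(Y)` is a CM field iff `Y` is of type IV; `Z(M_m(D)) = Z(D)`).

## The print

B. J. J. Moonen, Yu. G. Zarhin, *Weil classes on abelian varieties*, J. reine angew. Math. **496** (1998) 83–92 =
arXiv:alg-geom/9612017 [MoonenZarhin1998WeilClasses] (held text `paper:arxiv-alg-geom_9612017`).  §1 (chunk p0002
L46–L51): «Let `D = End⁰(Y)`, let `E` be the center of `D`, and let `E₀` be the maximal totally real subfield of `E`. We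
write `e₀ = [E₀:ℚ]`, `e = [E:ℚ]`, `d² = dim_E(D)`, and we say that `X` and `Y` are of type 1, 2, 3 or 4 if the algebra `D` is
of the corresponding type in the Albert classification.»  Criterion (2) (chunk p0003 L59–L80), VERBATIM: «Suppose `X` is
isogenous to a power `Y^m` of a simple abelian variety `Y` … Suppose `F ↪ End⁰(X)` is a subfield such that `W_F = ⋀^r_F V_X`
consists of Hodge classes … Then either all classes in `W_F` are decomposable, or all non-zero classes in `W_F` are
exceptional; this last possibility occurs precisely in the following cases: … `Y` is of Type 4, `d = 1`, `m = 1` and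
`F ⊄ E₀`, `Y` is of Type 4 with `d ≥ 2` or `m ≥ 2` and the map `θ : E₋ ↪ End_F(V_X) —Tr_F→ F` is non-zero.»  Proof
(chunk p0003 L92–L106): «Next assume that `X` is of type 4 with either `m ≥ 2` or `d ≥ 2`. We have `F ⊆ B = End⁰(X)`.
Since in this case `G_div(X)` is connected (see (Gdivprops)), it acts trivially on `W_F` if and only if the composition
`U_E = Z(G_div) ⊂ G_div(X) ↪ Gl_F(V_Y) —det_F→ F^*` is trivial. The torus `U_E` being connected, this is the case if
and only if the induced map on Lie algebras `θ : E₋ ↪ End_F(V_X) —Tr_F→ F` is zero.»  Lemma (chunk p0002 L121–L127,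
p0003 L1–L6): «The center of `G_div(X)` is the group `U_{K_B}` … For `X` of type 4 with either `d ≥ 2` or `m ≥ 2` this is
a connected torus of rank `e₀`»; «`Δ ⊗ ℂ = ∏_τ Δ_ℂ^{(τ)}`» (chunk p0002 L104–L118).
J. S. Milne, *Lefschetz classes on abelian varieties*, Duke Math. J. **96** (1999) [Milne1999LefschetzClasses], §1
pp. 642–644 (`C(A)`, `S(A)`, Remark 1.2 «the centralizer of `C(A)` in `End_k(V(A))` is `End⁰(A) ⊗_ℚ k`»), §2 p. 646
and p. 651 (type IV: «`E ⊗_ℚ ℝ → M_d(ℂ) × ⋯ × M_d(ℂ)` carrying a Rosati involution into `(a_ij) ↦ (ā_ji)`», «`Ē = M_d(k^al) ×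
M_d(k^al)`, `(α, β)† = (βᵗʳ, αᵗʳ)`»), Thm. 3.2, Cor. 4.5.

## What is proved

«`θ = 0`» is read, as in all the seat's type-4 files, as the eigenvalue BALANCE on `H¹(X(ℂ); ℂ)`:
`dim(V_ρ ∩ ker(ψ^* − σ)) = dim(V_ρ ∩ ker(ψ'^* − σ))` for every root `ρ` of `P` and every `σ` (its identification with
the print's trace map is explained in `WeilClassesFieldExceptionalOfCentralTorus`, «Relation to the print»).

* §1 ON THE CARRIER, for a SEMISIMPLE `Q_h`-adjoint-stable subalgebra `𝔅` of the pull-back algebra with centre in `ℂ[ψ^*]`,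
  `ψ^* ∈ 𝔅` central, `ψ'^* = (ψ^*)† ∈ ℂ[ψ^*]` without real place, a `ℂ`-basis `(ψ^{*j} b_k)_{j < deg R, k < r}` of `𝔅`, and
  `φ^* ∈ 𝔅`: **`weilClassesField_le_divisorClassesSpan_of_semisimple_of_forall_finrank_eq`** (balance ⟹ `W_F ⊗ ℂ ≤ 𝒟ᵐ ⊗ ℂ`;
  the adjoint-closed units of `InvolutionSecondKindMatrixUnits` fed to the seat's mechanism
  `CentralTorus.weilClassesField_le_divisorClassesSpan_of_matrixUnits_of_forall_finrank_eq`), `…_le_algebraicClasses_…`, and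
  with the torus half (`…ExceptionalOfCentralTorus`): **`…_iff_forall_finrank_eq_of_semisimple`**,
  **`…_inf_divisorClassesSpan_eq_bot_iff_exists_finrank_ne_of_semisimple`**, `…_le_or_inf_…_of_semisimple` (the dichotomy).
* §2 FROM `End(X)`-LEVEL DATA, for EVERY complex abelian variety `X` (powers `A^m` included) and every `φ ∈ End(X)`:
  `ψ ∈ End(X)` CENTRAL with `R(ψ) = 0` (`R` monic irreducible over `ℚ`), Rosati image `ψ'` (`Q_h(ψ^* x, y) =
  Q_h(x, ψ'^* y)`) with `N'ψ' ∈ ℤ[ψ]` and `ψ' ≠ ψ` (`E = ℚ(ψ)` is CM, `†` of the second kind on it), and **`hZ`: every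
  `g ∈ End(X)` commuting with `End(X)` has `N g ∈ ℤ[ψ]` for some `N ≠ 0`** («`Z(End⁰(X)) = E`»): then
  **`weilClassesField_le_divisorClassesSpan_iff_forall_finrank_eq_of_CMCentre_End`** («`W_F` decomposable ⟺ `θ = 0`»),
  **`weilClassesField_inf_divisorClassesSpan_eq_bot_iff_exists_finrank_ne_of_CMCentre_End`** («all non-zero classes
  exceptional ⟺ `θ ≠ 0`»), `weilClassesField_le_or_inf_divisorClassesSpan_eq_bot_of_CMCentre_End` (the dichotomy),
  `weilClassesField_le_algebraicClasses_of_CMCentre_End_of_forall_finrank_eq` — with `𝔅 = E''` the bicommutant.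

## Scope (honest column)

Positivity of the Rosati involution is not used; «type 4» is the hypothesis on the CENTRE (`E = ℚ(ψ)` with `ψ† ≠ ψ`),
the degree `d` and the multiplicity `m` do not appear (they are outputs: `d²m²e = dim_ℚ End⁰(X)`); «`θ = 0`» is the
eigenvalue balance on `H¹`.  Everything is on `ℂ`-points of Milne's `S(X)(h)` through the seat's carrier theorems
(Milne 1999 Thm. 3.2 / Cor. 4.5 in the tree); no algebraic groups, no connectedness argument — the print's «`G_div(X)`
is connected» is replaced by the explicit matrix units.

## References

* [MoonenZarhin1998WeilClasses] B. J. J. Moonen, Yu. G. Zarhin, Weil classes on abelian varieties, J. reine angew.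
  Math. 496 (1998) 83–92; arXiv:alg-geom/9612017: §1 Criterion (2) and its proof (chunk p0003 L59–L106), Lemma
  (chunk p0002 L121–L127), Tables 1–2.
* [Milne1999LefschetzClasses] J. S. Milne, Lefschetz classes on abelian varieties, Duke Math. J. 96 (1999) 639–675,
  §1 pp. 642–644, §2 pp. 646–651, Thm. 3.2, Cor. 4.5.
* [VoisinHodgeI2002] C. Voisin, Hodge Theory and Complex Algebraic Geometry I (CUP 2002), Thm. 11.30 (Lefschetz (1,1)).
* [MumfordAV1970] D. Mumford, Abelian Varieties (1970), §19 Cor. 2 of Thm. 1 (Poincaré: `End⁰` semisimple), §21.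

## Provenance

Lane `lit-hodgefound` (Track 2, Layer A), prover seat `lit-hodgefound-p21` (generation 25), row g25-#3 (successor note
(a) of generation 24: «type 4 with `d ≥ 3`»).
-/

noncomputable section

open CategoryTheory Polynomial Module
open Literature.AlgebraicTopology.SingularHomology
open Literature.AlgebraicGeometry.Motives
open Literature.AlgebraicGeometry.VanGeemen1994 (hodgeClassSpan pullbackOne mem_hodgeGroupOne_iff)
open Literature.AlgebraicGeometry.Milne1999
open Literature.Barriers.HodgeConjecture (divisorClassesSpan)
open Literature.RingTheory.SimpleModule (adj adj_spec' eq_adj_of_forall exists_matrixUnits_adj_eq_of_center_le_adjoin)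

namespace Literature.AlgebraicGeometry.HodgeTheory

/-! ### §0 (private) the complex roots of `R` -/

section Roots

/-- The complex roots of a monic integer polynomial irreducible over `ℚ`: simple, `deg R` of them, their nodal
polynomial is `R` itself. [folklore] -/
private theorem nodal_rootsFinset_eq {R : Polynomial ℤ} (hRm : R.Monic) (hRirr : Irreducible (R.map (Int.castRingHom ℚ))) :
    Lagrange.nodal (R.map (Int.castRingHom ℂ)).roots.toFinset id = R.map (Int.castRingHom ℂ) ∧
      (R.map (Int.castRingHom ℂ)).roots.toFinset.card = R.natDegree := by
  classical
  have hsep : (R.map (Int.castRingHom ℂ)).Separable := by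
    rw [map_castRingHom_complex_eq]
    exact hRirr.separable.map
  have hmon : (R.map (Int.castRingHom ℂ)).Monic := hRm.map _
  have hnodup : (R.map (Int.castRingHom ℂ)).roots.Nodup := Polynomial.nodup_roots hsep
  refine ⟨?_, ?_⟩
  · have hsplit := (IsAlgClosed.splits (R.map (Int.castRingHom ℂ))).eq_prod_roots_of_monic hmon
    rw [Lagrange.nodal_eq, ← Multiset.toFinset_eq hnodup, Finset.prod_mk]
    exact hsplit.symm
  · rw [Multiset.toFinset_card_of_nodup hnodup, ← Polynomial.Splits.natDegree_eq_card_roots (IsAlgClosed.splits _),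
      Polynomial.natDegree_map_eq_of_injective (Int.castRingHom ℂ).injective_int]

end Roots

/-! ### §1 ON THE CARRIER: a semisimple `Q_h`-adjoint-stable algebra with CM centre `ℂ[ψ^*]` -/

section Carrier

variable {A : AbelianVariety ℂ} {h : complexBetti A.X 2} {φ ψ ψ' : A ⟶ A} {P R : Polynomial ℤ} {e m r : ℕ}
  {𝔅 : Subalgebra ℂ (Module.End ℂ (complexBetti A.X 1))} {b : Fin r → Module.End ℂ (complexBetti A.X 1)}

/-- **TYPE 4, ANY `d`, `m` — THE DECOMPOSABLE HALF ON THE CARRIER.**  `A` a complex abelian variety, `h ∈ B¹ ⊗ ℂ` with `Q_h`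
non-degenerate; `𝔅` a SEMISIMPLE subalgebra of the `ℂ`-algebra generated by the pull-backs, stable under `Q_h`-adjoints
(«`End⁰(X) ⊗ ℂ`, `†`-stable»); `ψ ∈ End(A)` with `ψ^* ∈ 𝔅` central in `𝔅`, `R(ψ) = 0` (`R` monic irreducible over `ℚ`),
Rosati image `ψ'` with `ψ'^* ∈ ℂ[ψ^*]` and no real place `ker(ψ^* − σ) ∩ ker(ψ'^* − σ) = 0`; the CENTRE of `𝔅` lies in
`ℂ[ψ^*]` and `𝔅` has a `ℂ`-basis `(ψ^{*j} b_k)_{j < deg R, k < r}` («`Z(End⁰ X) = E = ℚ(ψ)` CM, `dim_E End⁰ X = r`»);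
`F = ℚ(φ)` with `φ^* ∈ 𝔅`, `P(φ) = 0`, `P` monic irreducible of degree `e`, `e · 2m = 2 dim A`.  IF the multiplicities
BALANCE, `dim(V_ρ ∩ ker(ψ^* − σ)) = dim(V_ρ ∩ ker(ψ'^* − σ))` for all roots `ρ` of `P` and all `σ` («`θ = 0`»), THEN
`W_F ⊗ ℂ ≤ 𝒟ᵐ ⊗ ℂ`.  Proof: `InvolutionSecondKindMatrixUnits` gives adjoint-closed matrix units `U_{ab} ∈ 𝔅` commuting
with `ψ^*` with `𝔅 ⊆ ℂ⟨ψ^*, U⟩`; then the seat's mechanism `CentralTorus.…_of_matrixUnits_of_forall_finrank_eq`.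
[cite: MoonenZarhin1998WeilClasses, §1 Criterion (2), cases «Type 4» and their proof (chunk p0003 L59–L106)]
[cite: Milne1999LefschetzClasses, §2 p. 651 («Ē = M_d(k^al) × M_d(k^al), (α, β)† = (βᵗʳ, αᵗʳ)»), Thm. 3.2, Cor. 4.5] -/
theorem weilClassesField_le_divisorClassesSpan_of_semisimple_of_forall_finrank_eq (hPm : P.Monic) (hPe : P.natDegree = e)
    (hPirr : Irreducible (P.map (Int.castRingHom ℚ)))
    (hφ : Polynomial.eval₂ (Int.castRingHom (CategoryTheory.End A)) (φ : CategoryTheory.End A) P = 0)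
    (her : e * (2 * m) = 2 * A.dim) (hm : m ≠ 0) (hh : h ∈ hodgeClassSpan A.dim A.X 1)
    (hnd : ∀ x : complexBetti A.X 1, (∀ y, polarizationPairingOne A.X h (A.dim - 1) x y = 0) → x = 0)
    [IsSemisimpleRing 𝔅] (h𝔅 : 𝔅 ≤ Algebra.adjoin ℂ (Set.range fun χ : A ⟶ A ↦ pullbackOne A χ))
    (h𝔅adj : ∀ X ∈ 𝔅, ∃ X' ∈ 𝔅, ∀ x y : complexBetti A.X 1,
      polarizationPairingOne A.X h (A.dim - 1) (X x) y = polarizationPairingOne A.X h (A.dim - 1) x (X' y))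
    (hψ𝔅 : pullbackOne A ψ ∈ 𝔅) (hψc : ∀ X ∈ 𝔅, X * pullbackOne A ψ = pullbackOne A ψ * X)
    (hRm : R.Monic) (hRirr : Irreducible (R.map (Int.castRingHom ℚ)))
    (hψR : Polynomial.eval₂ (Int.castRingHom (CategoryTheory.End A)) (ψ : CategoryTheory.End A) R = 0)
    (hψ' : pullbackOne A ψ' ∈ Algebra.adjoin ℂ ({pullbackOne A ψ} : Set (Module.End ℂ (complexBetti A.X 1))))
    (hadj : ∀ x y : complexBetti A.X 1, polarizationPairingOne A.X h (A.dim - 1) (pullbackOne A ψ x) y =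
      polarizationPairingOne A.X h (A.dim - 1) x (pullbackOne A ψ' y))
    (hCM : ∀ σ : ℂ, (pullbackOne A ψ).eigenspace σ ⊓ (pullbackOne A ψ').eigenspace σ = ⊥)
    (hZ : ∀ z ∈ 𝔅, (∀ X ∈ 𝔅, X * z = z * X) →
      z ∈ Algebra.adjoin ℂ ({pullbackOne A ψ} : Set (Module.End ℂ (complexBetti A.X 1))))
    (hb : LinearIndependent ℂ (fun jk : Fin R.natDegree × Fin r ↦ pullbackOne A ψ ^ (jk.1 : ℕ) * b jk.2))
    (hspan : Subalgebra.toSubmodule 𝔅 =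
      Submodule.span ℂ (Set.range fun jk : Fin R.natDegree × Fin r ↦ pullbackOne A ψ ^ (jk.1 : ℕ) * b jk.2))
    (hF : pullbackOne A φ ∈ 𝔅)
    (hbal : ∀ ρ : ℂ, Polynomial.eval₂ (Int.castRingHom ℂ) ρ P = 0 → ∀ σ : ℂ,
      Module.finrank ℂ ↥((pullbackOne A φ).eigenspace ρ ⊓ (pullbackOne A ψ).eigenspace σ) =
        Module.finrank ℂ ↥((pullbackOne A φ).eigenspace ρ ⊓ (pullbackOne A ψ').eigenspace σ)) :
    weilClassesField A φ P (2 * m) ≤ divisorClassesSpan A.X A.dim m := by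
  classical
  haveI : Module.Finite ℂ (complexBetti A.X 1) := abelianVarietyCohomologyExteriorH1_holds.finite_one A
  set Q := polarizationPairingOne A.X h (A.dim - 1) with hQdef
  set T : Module.End ℂ (complexBetti A.X 1) := pullbackOne A ψ with hTdef
  set T' : Module.End ℂ (complexBetti A.X 1) := pullbackOne A ψ' with hT'def
  -- `H¹ ≠ 0`
  have hApos : 0 < A.dim := by
    have hpos : 0 < (P.map (Int.castRingHom ℚ)).natDegree := Polynomial.natDegree_pos_iff_degree_pos.2
      (Polynomial.degree_pos_of_irreducible hPirr)
    rw [Polynomial.natDegree_map_eq_of_injective (RingHom.injective_int _), hPe] at hpos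
    have : 0 < e * (2 * m) := Nat.mul_pos hpos (Nat.mul_pos two_pos (Nat.pos_of_ne_zero hm))
    omega
  haveI : Nontrivial (complexBetti A.X 1) := Module.nontrivial_of_finrank_pos (R := ℂ)
    (by rw [AbelianVariety.finrank_complexBetti_one]; omega)
  -- the scalar form `B = λ ∘ Q_h`
  obtain ⟨B, hBalt, hBnd, lam, hlam, hBQ⟩ := exists_bilinForm_isAlt_nondegenerate (A := A) hnd
  -- `Q_h`-adjoints are `B`-adjoints
  have hadjB : ∀ {X X' : Module.End ℂ (complexBetti A.X 1)}, (∀ x y, Q (X x) y = Q x (X' y)) → adj B hBnd X = X' := by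
    intro X X' hXX'
    symm
    refine eq_adj_of_forall B hBnd fun v w ↦ ?_
    rw [← hBalt.neg_eq, ← hBalt.neg_eq (X w), hBQ, hBQ, hXX']
  have hE : ∀ X ∈ 𝔅, adj B hBnd X ∈ 𝔅 := by
    intro X hX
    obtain ⟨X', hX'𝔅, hXX'⟩ := h𝔅adj X hX
    rw [hadjB hXX']
    exact hX'𝔅
  have hTadj : adj B hBnd T = T' := hadjB hadj
  have hCM' : ∀ σ : ℂ, T.eigenspace σ ⊓ (adj B hBnd T).eigenspace σ = ⊥ := fun σ ↦ by rw [hTadj]; exact hCM σ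
  -- the roots of `R`
  set s : Finset ℂ := (R.map (Int.castRingHom ℂ)).roots.toFinset with hsdef
  obtain ⟨hnodal, hscard⟩ := nodal_rootsFinset_eq hRm hRirr
  have hTs : aeval T (Lagrange.nodal s id) = 0 := by
    rw [hnodal]; exact aeval_hom_complexBetti_map_one_eq_zero hψR
  -- reindex the basis along `Fin (deg R) ≃ Fin #s`
  let ε : Fin s.card × Fin r ≃ Fin R.natDegree × Fin r := (finCongr hscard).prodCongr (Equiv.refl _)
  have hcomp : (fun jk : Fin s.card × Fin r ↦ T ^ (jk.1 : ℕ) * b jk.2) =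
      (fun jk : Fin R.natDegree × Fin r ↦ T ^ (jk.1 : ℕ) * b jk.2) ∘ ε := by
    funext jk; rfl
  have hb' : LinearIndependent ℂ (fun jk : Fin s.card × Fin r ↦ T ^ (jk.1 : ℕ) * b jk.2) := by
    rw [hcomp, linearIndependent_equiv]; exact hb
  have hspan' : Subalgebra.toSubmodule 𝔅 =
      Submodule.span ℂ (Set.range fun jk : Fin s.card × Fin r ↦ T ^ (jk.1 : ℕ) * b jk.2) := by
    rw [hcomp, ε.surjective.range_comp]; exact hspan
  -- the adjoint-closed matrix units
  obtain ⟨d, U, hd, -, hUmem, hUmul, hUsum, hUadj, hUT, h𝔅U⟩ :=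
    exists_matrixUnits_adj_eq_of_center_le_adjoin B hBnd hBalt 𝔅 hE hψ𝔅 hψc s hTs hZ hCM' hb' hspan'
  haveI : NeZero d := ⟨Nat.pos_iff_ne_zero.1 hd⟩
  -- feed the mechanism
  refine CentralTorus.weilClassesField_le_divisorClassesSpan_of_matrixUnits_of_forall_finrank_eq (ι := Fin d) (U := U)
    hPm hPe hPirr hφ her hh hnd (h𝔅 hψ𝔅) hRm hRirr (aeval_hom_complexBetti_map_one_eq_zero hψR) hψ' hadj hCM
    (0 : Fin d) (fun a c ↦ h𝔅 (hUmem a c)) hUmul hUsum (fun a c x y ↦ ?_) (fun a c ↦ (hUT a c).symm) (h𝔅U hF) hbal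
  -- `Q_h(U_{ac} x, y) = Q_h(x, U_{ca} y)` from `U_{ac}† = U_{ca}`
  apply hlam
  rw [← hBQ, ← hBQ, adj_spec' B hBnd hBalt, hUadj]

/-- **… hence ALGEBRAIC** (`W_F ⊗ ℂ ≤ algebraicClasses A.X m`: Lefschetz (1,1) and products).
[cite: MoonenZarhin1998WeilClasses, Introduction (chunk p0001 L10–L18) and §1 Criterion (2) (chunk p0003 L59–L80)]
[cite: VoisinHodgeI2002, Thm. 11.30] -/
theorem weilClassesField_le_algebraicClasses_of_semisimple_of_forall_finrank_eq (hPm : P.Monic) (hPe : P.natDegree = e)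
    (hPirr : Irreducible (P.map (Int.castRingHom ℚ)))
    (hφ : Polynomial.eval₂ (Int.castRingHom (CategoryTheory.End A)) (φ : CategoryTheory.End A) P = 0)
    (her : e * (2 * m) = 2 * A.dim) (hm : m ≠ 0) (hh : h ∈ hodgeClassSpan A.dim A.X 1)
    (hnd : ∀ x : complexBetti A.X 1, (∀ y, polarizationPairingOne A.X h (A.dim - 1) x y = 0) → x = 0)
    [IsSemisimpleRing 𝔅] (h𝔅 : 𝔅 ≤ Algebra.adjoin ℂ (Set.range fun χ : A ⟶ A ↦ pullbackOne A χ))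
    (h𝔅adj : ∀ X ∈ 𝔅, ∃ X' ∈ 𝔅, ∀ x y : complexBetti A.X 1,
      polarizationPairingOne A.X h (A.dim - 1) (X x) y = polarizationPairingOne A.X h (A.dim - 1) x (X' y))
    (hψ𝔅 : pullbackOne A ψ ∈ 𝔅) (hψc : ∀ X ∈ 𝔅, X * pullbackOne A ψ = pullbackOne A ψ * X)
    (hRm : R.Monic) (hRirr : Irreducible (R.map (Int.castRingHom ℚ)))
    (hψR : Polynomial.eval₂ (Int.castRingHom (CategoryTheory.End A)) (ψ : CategoryTheory.End A) R = 0)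
    (hψ' : pullbackOne A ψ' ∈ Algebra.adjoin ℂ ({pullbackOne A ψ} : Set (Module.End ℂ (complexBetti A.X 1))))
    (hadj : ∀ x y : complexBetti A.X 1, polarizationPairingOne A.X h (A.dim - 1) (pullbackOne A ψ x) y =
      polarizationPairingOne A.X h (A.dim - 1) x (pullbackOne A ψ' y))
    (hCM : ∀ σ : ℂ, (pullbackOne A ψ).eigenspace σ ⊓ (pullbackOne A ψ').eigenspace σ = ⊥)
    (hZ : ∀ z ∈ 𝔅, (∀ X ∈ 𝔅, X * z = z * X) →
      z ∈ Algebra.adjoin ℂ ({pullbackOne A ψ} : Set (Module.End ℂ (complexBetti A.X 1))))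
    (hb : LinearIndependent ℂ (fun jk : Fin R.natDegree × Fin r ↦ pullbackOne A ψ ^ (jk.1 : ℕ) * b jk.2))
    (hspan : Subalgebra.toSubmodule 𝔅 =
      Submodule.span ℂ (Set.range fun jk : Fin R.natDegree × Fin r ↦ pullbackOne A ψ ^ (jk.1 : ℕ) * b jk.2))
    (hF : pullbackOne A φ ∈ 𝔅)
    (hbal : ∀ ρ : ℂ, Polynomial.eval₂ (Int.castRingHom ℂ) ρ P = 0 → ∀ σ : ℂ,
      Module.finrank ℂ ↥((pullbackOne A φ).eigenspace ρ ⊓ (pullbackOne A ψ).eigenspace σ) =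
        Module.finrank ℂ ↥((pullbackOne A φ).eigenspace ρ ⊓ (pullbackOne A ψ').eigenspace σ)) :
    weilClassesField A φ P (2 * m) ≤ algebraicClasses A.X m :=
  (weilClassesField_le_divisorClassesSpan_of_semisimple_of_forall_finrank_eq hPm hPe hPirr hφ her hm hh hnd h𝔅 h𝔅adj hψ𝔅 hψc
    hRm hRirr hψR hψ' hadj hCM hZ hb hspan hF hbal).trans
    (AbelianVariety.divisorClassesSpan_le_algebraicClasses A
      (fun c hc hc' ↦ lefschetzOneOne_rational_holds (AbelianVariety.isSmoothProjective_holds (A := A)) c hc hc') m)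

/-- **«`W_F` DECOMPOSABLE ⟺ `θ = 0`», TYPE 4, ANY `d`, `m`, ON THE CARRIER** (`ψ^* ∈ C(A) ⊗ ℂ` for the torus half).
[cite: MoonenZarhin1998WeilClasses, §1 Criterion (2), cases «Type 4» and their proof (chunk p0003 L59–L106)]
[cite: Milne1999LefschetzClasses, §1 pp. 642–644, Thm. 3.2, Cor. 4.5] -/
theorem weilClassesField_le_divisorClassesSpan_iff_forall_finrank_eq_of_semisimple (hPm : P.Monic) (hPe : P.natDegree = e)
    (hPirr : Irreducible (P.map (Int.castRingHom ℚ)))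
    (hφ : Polynomial.eval₂ (Int.castRingHom (CategoryTheory.End A)) (φ : CategoryTheory.End A) P = 0)
    (her : e * (2 * m) = 2 * A.dim) (hm : m ≠ 0) (hh : h ∈ hodgeClassSpan A.dim A.X 1)
    (hnd : ∀ x : complexBetti A.X 1, (∀ y, polarizationPairingOne A.X h (A.dim - 1) x y = 0) → x = 0)
    [IsSemisimpleRing 𝔅] (h𝔅 : 𝔅 ≤ Algebra.adjoin ℂ (Set.range fun χ : A ⟶ A ↦ pullbackOne A χ))
    (h𝔅adj : ∀ X ∈ 𝔅, ∃ X' ∈ 𝔅, ∀ x y : complexBetti A.X 1,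
      polarizationPairingOne A.X h (A.dim - 1) (X x) y = polarizationPairingOne A.X h (A.dim - 1) x (X' y))
    (hψ𝔅 : pullbackOne A ψ ∈ 𝔅) (hψc : ∀ X ∈ 𝔅, X * pullbackOne A ψ = pullbackOne A ψ * X)
    (hψC : pullbackOne A ψ ∈ centralizerAlgebra A)
    (hRm : R.Monic) (hRirr : Irreducible (R.map (Int.castRingHom ℚ)))
    (hψR : Polynomial.eval₂ (Int.castRingHom (CategoryTheory.End A)) (ψ : CategoryTheory.End A) R = 0)
    (hψ' : pullbackOne A ψ' ∈ Algebra.adjoin ℂ ({pullbackOne A ψ} : Set (Module.End ℂ (complexBetti A.X 1))))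
    (hadj : ∀ x y : complexBetti A.X 1, polarizationPairingOne A.X h (A.dim - 1) (pullbackOne A ψ x) y =
      polarizationPairingOne A.X h (A.dim - 1) x (pullbackOne A ψ' y))
    (hCM : ∀ σ : ℂ, (pullbackOne A ψ).eigenspace σ ⊓ (pullbackOne A ψ').eigenspace σ = ⊥)
    (hZ : ∀ z ∈ 𝔅, (∀ X ∈ 𝔅, X * z = z * X) →
      z ∈ Algebra.adjoin ℂ ({pullbackOne A ψ} : Set (Module.End ℂ (complexBetti A.X 1))))
    (hb : LinearIndependent ℂ (fun jk : Fin R.natDegree × Fin r ↦ pullbackOne A ψ ^ (jk.1 : ℕ) * b jk.2))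
    (hspan : Subalgebra.toSubmodule 𝔅 =
      Submodule.span ℂ (Set.range fun jk : Fin R.natDegree × Fin r ↦ pullbackOne A ψ ^ (jk.1 : ℕ) * b jk.2))
    (hF : pullbackOne A φ ∈ 𝔅) :
    weilClassesField A φ P (2 * m) ≤ divisorClassesSpan A.X A.dim m ↔
      ∀ ρ : ℂ, Polynomial.eval₂ (Int.castRingHom ℂ) ρ P = 0 → ∀ σ : ℂ,
        Module.finrank ℂ ↥((pullbackOne A φ).eigenspace ρ ⊓ (pullbackOne A ψ).eigenspace σ) =
          Module.finrank ℂ ↥((pullbackOne A φ).eigenspace ρ ⊓ (pullbackOne A ψ').eigenspace σ) := by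
  refine ⟨fun hle ρ hρ σ ↦ ?_, fun hbal ↦
    weilClassesField_le_divisorClassesSpan_of_semisimple_of_forall_finrank_eq hPm hPe hPirr hφ her hm hh hnd h𝔅 h𝔅adj hψ𝔅 hψc
      hRm hRirr hψR hψ' hadj hCM hZ hb hspan hF hbal⟩
  by_contra hne
  have hbot := weilClassesField_inf_divisorClassesSpan_eq_bot_of_central_of_finrank_ne hPm hPe hPirr hφ her hm hh hnd hψC hRirr
    hψR hψ' hadj hρ hne
  rw [inf_eq_left.2 hle] at hbot
  exact weilClassesField_ne_bot hPe hPirr hφ her (Nat.mul_ne_zero two_ne_zero hm) hbot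

/-- **«ALL NON-ZERO CLASSES EXCEPTIONAL ⟺ `θ ≠ 0`», TYPE 4, ANY `d`, `m`, ON THE CARRIER.**
[cite: MoonenZarhin1998WeilClasses, §1 Criterion (2), cases «Type 4» and their proof (chunk p0003 L59–L106)]
[cite: Milne1999LefschetzClasses, §1 pp. 642–644, Thm. 3.2, Cor. 4.5] -/
theorem weilClassesField_inf_divisorClassesSpan_eq_bot_iff_exists_finrank_ne_of_semisimple (hPm : P.Monic)
    (hPe : P.natDegree = e) (hPirr : Irreducible (P.map (Int.castRingHom ℚ)))
    (hφ : Polynomial.eval₂ (Int.castRingHom (CategoryTheory.End A)) (φ : CategoryTheory.End A) P = 0)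
    (her : e * (2 * m) = 2 * A.dim) (hm : m ≠ 0) (hh : h ∈ hodgeClassSpan A.dim A.X 1)
    (hnd : ∀ x : complexBetti A.X 1, (∀ y, polarizationPairingOne A.X h (A.dim - 1) x y = 0) → x = 0)
    [IsSemisimpleRing 𝔅] (h𝔅 : 𝔅 ≤ Algebra.adjoin ℂ (Set.range fun χ : A ⟶ A ↦ pullbackOne A χ))
    (h𝔅adj : ∀ X ∈ 𝔅, ∃ X' ∈ 𝔅, ∀ x y : complexBetti A.X 1,
      polarizationPairingOne A.X h (A.dim - 1) (X x) y = polarizationPairingOne A.X h (A.dim - 1) x (X' y))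
    (hψ𝔅 : pullbackOne A ψ ∈ 𝔅) (hψc : ∀ X ∈ 𝔅, X * pullbackOne A ψ = pullbackOne A ψ * X)
    (hψC : pullbackOne A ψ ∈ centralizerAlgebra A)
    (hRm : R.Monic) (hRirr : Irreducible (R.map (Int.castRingHom ℚ)))
    (hψR : Polynomial.eval₂ (Int.castRingHom (CategoryTheory.End A)) (ψ : CategoryTheory.End A) R = 0)
    (hψ' : pullbackOne A ψ' ∈ Algebra.adjoin ℂ ({pullbackOne A ψ} : Set (Module.End ℂ (complexBetti A.X 1))))
    (hadj : ∀ x y : complexBetti A.X 1, polarizationPairingOne A.X h (A.dim - 1) (pullbackOne A ψ x) y =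
      polarizationPairingOne A.X h (A.dim - 1) x (pullbackOne A ψ' y))
    (hCM : ∀ σ : ℂ, (pullbackOne A ψ).eigenspace σ ⊓ (pullbackOne A ψ').eigenspace σ = ⊥)
    (hZ : ∀ z ∈ 𝔅, (∀ X ∈ 𝔅, X * z = z * X) →
      z ∈ Algebra.adjoin ℂ ({pullbackOne A ψ} : Set (Module.End ℂ (complexBetti A.X 1))))
    (hb : LinearIndependent ℂ (fun jk : Fin R.natDegree × Fin r ↦ pullbackOne A ψ ^ (jk.1 : ℕ) * b jk.2))
    (hspan : Subalgebra.toSubmodule 𝔅 =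
      Submodule.span ℂ (Set.range fun jk : Fin R.natDegree × Fin r ↦ pullbackOne A ψ ^ (jk.1 : ℕ) * b jk.2))
    (hF : pullbackOne A φ ∈ 𝔅) :
    weilClassesField A φ P (2 * m) ⊓ divisorClassesSpan A.X A.dim m = ⊥ ↔
      ∃ ρ σ : ℂ, Polynomial.eval₂ (Int.castRingHom ℂ) ρ P = 0 ∧
        Module.finrank ℂ ↥((pullbackOne A φ).eigenspace ρ ⊓ (pullbackOne A ψ).eigenspace σ) ≠
          Module.finrank ℂ ↥((pullbackOne A φ).eigenspace ρ ⊓ (pullbackOne A ψ').eigenspace σ) := by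
  refine ⟨fun hbot ↦ ?_, fun ⟨ρ, σ, hρ, hne⟩ ↦
    weilClassesField_inf_divisorClassesSpan_eq_bot_of_central_of_finrank_ne hPm hPe hPirr hφ her hm hh hnd hψC hRirr hψR hψ'
      hadj hρ hne⟩
  by_contra hall
  push Not at hall
  have hle := weilClassesField_le_divisorClassesSpan_of_semisimple_of_forall_finrank_eq hPm hPe hPirr hφ her hm hh hnd h𝔅 h𝔅adj
    hψ𝔅 hψc hRm hRirr hψR hψ' hadj hCM hZ hb hspan hF fun ρ hρ σ ↦ hall ρ σ hρ
  rw [inf_eq_left.2 hle] at hbot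
  exact weilClassesField_ne_bot hPe hPirr hφ her (Nat.mul_ne_zero two_ne_zero hm) hbot

/-- **THE DICHOTOMY, TYPE 4, ANY `d`, `m`, ON THE CARRIER**: «either all classes in `W_F` are decomposable or all non-zero
classes in `W_F` are exceptional». [cite: MoonenZarhin1998WeilClasses, §1 Criterion (2) (chunk p0003 L59–L67)] -/
theorem weilClassesField_le_or_inf_divisorClassesSpan_eq_bot_of_semisimple (hPm : P.Monic) (hPe : P.natDegree = e)
    (hPirr : Irreducible (P.map (Int.castRingHom ℚ)))
    (hφ : Polynomial.eval₂ (Int.castRingHom (CategoryTheory.End A)) (φ : CategoryTheory.End A) P = 0)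
    (her : e * (2 * m) = 2 * A.dim) (hm : m ≠ 0) (hh : h ∈ hodgeClassSpan A.dim A.X 1)
    (hnd : ∀ x : complexBetti A.X 1, (∀ y, polarizationPairingOne A.X h (A.dim - 1) x y = 0) → x = 0)
    [IsSemisimpleRing 𝔅] (h𝔅 : 𝔅 ≤ Algebra.adjoin ℂ (Set.range fun χ : A ⟶ A ↦ pullbackOne A χ))
    (h𝔅adj : ∀ X ∈ 𝔅, ∃ X' ∈ 𝔅, ∀ x y : complexBetti A.X 1,
      polarizationPairingOne A.X h (A.dim - 1) (X x) y = polarizationPairingOne A.X h (A.dim - 1) x (X' y))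
    (hψ𝔅 : pullbackOne A ψ ∈ 𝔅) (hψc : ∀ X ∈ 𝔅, X * pullbackOne A ψ = pullbackOne A ψ * X)
    (hψC : pullbackOne A ψ ∈ centralizerAlgebra A)
    (hRm : R.Monic) (hRirr : Irreducible (R.map (Int.castRingHom ℚ)))
    (hψR : Polynomial.eval₂ (Int.castRingHom (CategoryTheory.End A)) (ψ : CategoryTheory.End A) R = 0)
    (hψ' : pullbackOne A ψ' ∈ Algebra.adjoin ℂ ({pullbackOne A ψ} : Set (Module.End ℂ (complexBetti A.X 1))))
    (hadj : ∀ x y : complexBetti A.X 1, polarizationPairingOne A.X h (A.dim - 1) (pullbackOne A ψ x) y =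
      polarizationPairingOne A.X h (A.dim - 1) x (pullbackOne A ψ' y))
    (hCM : ∀ σ : ℂ, (pullbackOne A ψ).eigenspace σ ⊓ (pullbackOne A ψ').eigenspace σ = ⊥)
    (hZ : ∀ z ∈ 𝔅, (∀ X ∈ 𝔅, X * z = z * X) →
      z ∈ Algebra.adjoin ℂ ({pullbackOne A ψ} : Set (Module.End ℂ (complexBetti A.X 1))))
    (hb : LinearIndependent ℂ (fun jk : Fin R.natDegree × Fin r ↦ pullbackOne A ψ ^ (jk.1 : ℕ) * b jk.2))
    (hspan : Subalgebra.toSubmodule 𝔅 =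
      Submodule.span ℂ (Set.range fun jk : Fin R.natDegree × Fin r ↦ pullbackOne A ψ ^ (jk.1 : ℕ) * b jk.2))
    (hF : pullbackOne A φ ∈ 𝔅) :
    weilClassesField A φ P (2 * m) ≤ divisorClassesSpan A.X A.dim m ∨
      weilClassesField A φ P (2 * m) ⊓ divisorClassesSpan A.X A.dim m = ⊥ := by
  by_cases hbal : ∀ ρ : ℂ, Polynomial.eval₂ (Int.castRingHom ℂ) ρ P = 0 → ∀ σ : ℂ,
      Module.finrank ℂ ↥((pullbackOne A φ).eigenspace ρ ⊓ (pullbackOne A ψ).eigenspace σ) =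
        Module.finrank ℂ ↥((pullbackOne A φ).eigenspace ρ ⊓ (pullbackOne A ψ').eigenspace σ)
  · exact Or.inl (weilClassesField_le_divisorClassesSpan_of_semisimple_of_forall_finrank_eq hPm hPe hPirr hφ her hm hh hnd h𝔅
      h𝔅adj hψ𝔅 hψc hRm hRirr hψR hψ' hadj hCM hZ hb hspan hF hbal)
  · push Not at hbal
    obtain ⟨ρ, hρ, σ, hne⟩ := hbal
    exact Or.inr (weilClassesField_inf_divisorClassesSpan_eq_bot_of_central_of_finrank_ne hPm hPe hPirr hφ her hm hh hnd hψC
      hRirr hψR hψ' hadj hρ hne)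

end Carrier

/-! ### §2 FROM `End(X)`-LEVEL DATA: «the centre of `End⁰(X)` is the CM field `E = ℚ(ψ)`» — every `X`, `d`, `m` -/

section EndLevel

variable {A : AbelianVariety ℂ} {h : complexBetti A.X 2} {φ ψ ψ' : A ⟶ A} {P R : Polynomial ℤ} {e m : ℕ}

/-- A central `ψ ∈ End(A)` has `ψ^* ∈ C(A) ⊗ ℂ`. [cite: Milne1999LefschetzClasses, §1 p. 642 (C(A))] -/
private theorem pullbackOne_mem_centralizerAlgebra_of_central' (hψ : ∀ χ : A ⟶ A, ψ ≫ χ = χ ≫ ψ) :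
    pullbackOne A ψ ∈ centralizerAlgebra A := by
  refine mem_centralizerAlgebra_iff.2 fun χ ↦ ?_
  rw [← pullbackOne_comp_eq_mul, ← pullbackOne_comp_eq_mul, hψ χ]

/-- **The data of §1 for the bicommutant `E'' = End⁰(X) ⊗ ℂ`.**  For `h ∈ B¹(A) ⊗ ℂ` with `Q_h` non-degenerate and
`ψ ∈ End(A)` central with `R(ψ) = 0` (`R` monic irreducible over `ℚ`) such that every central `g ∈ End(A)` has a non-zero
multiple in `ℤ[ψ]`: the bicommutant is a semisimple subalgebra of the pull-back algebra, stable under `Q_h`-adjoints,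
containing `ψ^*` in its centre, with centre inside `ℂ[ψ^*]`, and has a `ℂ`-basis `(ψ^{*j} b_k)_{j < deg R, k < r}`.
[cite: Milne1999LefschetzClasses, §1 pp. 642–644 and Remark 1.2, §2 p. 646] [cite: MumfordAV1970, §19 Cor. 2 of Thm. 1] -/
theorem bicommutant_typeFour_data (hh : h ∈ hodgeClassSpan A.dim A.X 1)
    (hnd : ∀ x : complexBetti A.X 1, (∀ y, polarizationPairingOne A.X h (A.dim - 1) x y = 0) → x = 0)
    (hψ : ∀ χ : A ⟶ A, ψ ≫ χ = χ ≫ ψ) (hRm : R.Monic) (hRirr : Irreducible (R.map (Int.castRingHom ℚ)))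
    (hψR : Polynomial.eval₂ (Int.castRingHom (CategoryTheory.End A)) (ψ : CategoryTheory.End A) R = 0)
    (hZ : ∀ g : A ⟶ A, (∀ χ : A ⟶ A, g ≫ χ = χ ≫ g) →
      ∃ N : ℤ, N ≠ 0 ∧ End.of (N • g) ∈ Subring.closure {End.of ψ}) :
    bicommutant A ≤ Algebra.adjoin ℂ (Set.range fun χ : A ⟶ A ↦ pullbackOne A χ) ∧
    (∀ X ∈ bicommutant A, ∃ X' ∈ bicommutant A, ∀ x y : complexBetti A.X 1,
      polarizationPairingOne A.X h (A.dim - 1) (X x) y = polarizationPairingOne A.X h (A.dim - 1) x (X' y)) ∧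
    pullbackOne A ψ ∈ bicommutant A ∧ (∀ X ∈ bicommutant A, X * pullbackOne A ψ = pullbackOne A ψ * X) ∧
    (∀ z ∈ bicommutant A, (∀ X ∈ bicommutant A, X * z = z * X) →
      z ∈ Algebra.adjoin ℂ ({pullbackOne A ψ} : Set (Module.End ℂ (complexBetti A.X 1)))) ∧
    ∃ (r : ℕ) (b : Fin r → Module.End ℂ (complexBetti A.X 1)),
      LinearIndependent ℂ (fun jk : Fin R.natDegree × Fin r ↦ pullbackOne A ψ ^ (jk.1 : ℕ) * b jk.2) ∧
      Subalgebra.toSubmodule (bicommutant A) =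
        Submodule.span ℂ (Set.range fun jk : Fin R.natDegree × Fin r ↦ pullbackOne A ψ ^ (jk.1 : ℕ) * b jk.2) := by
  classical
  haveI : Module.Finite ℂ (complexBetti A.X 1) := abelianVarietyCohomologyExteriorH1_holds.finite_one A
  have hψC := pullbackOne_mem_centralizerAlgebra_of_central' hψ
  refine ⟨?_, ?_, pullbackOne_mem_bicommutant ψ, ?_, ?_, ?_⟩
  · -- `E''` lies in (indeed equals) the pull-back algebra
    intro X hX
    rw [mem_bicommutant_iff_mem_span] at hX
    exact Algebra.span_le_adjoin ℂ _ hX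
  · -- `Q_h`-adjoints stay in `E''`
    obtain ⟨B, hBalt, hBnd, lam, hlam, hBQ⟩ := exists_bilinForm_isAlt_nondegenerate (A := A) hnd
    have hBHg : ∀ g ∈ hodgeGroup A.dim A.X, ∀ v w : complexBetti A.X 1, B (g 1 v) (g 1 w) = B v w := fun g hg v w ↦ by
      rw [hBQ, hBQ, (hodgeGroupOne_le_unitaryCentralizerGroup hh (mem_hodgeGroupOne_iff.2 ⟨g, hg, rfl⟩)).2 v w]
    intro X hX
    obtain ⟨X', hX'⟩ := exists_rightAdjoint hBnd X
    refine ⟨X', rightAdjoint_mem_bicommutant hBnd hBHg hX hX', fun x y ↦ hlam ?_⟩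
    rw [← hBQ, ← hBQ, ← hBalt.neg_eq, hX', hBalt.neg_eq]
  · -- `ψ^*` is central in `E''`
    intro X hX
    exact ((Subalgebra.mem_centralizer_iff ℂ).1 hX _ hψC).symm
  · -- the centre of `E''` is `ℂ[ψ^*]`
    intro z hz hzc
    exact mem_adjoin_pullbackOne_of_center_le (center_le_adjoin_of_forall_central hZ) hz hzc
  · -- the basis over `ℂ[ψ^*]`
    obtain ⟨r, b, -, -, hb, hspan⟩ := exists_basis_pow_mul_of_central hψ hRm hRirr hψR
    exact ⟨r, b, hb, hspan⟩

/-- **MZ98 CRITERION (2), TYPE 4 FOR EVERY `d` AND `m`, FROM `End(X)` — «`W_F` DECOMPOSABLE ⟺ `θ = 0`».**  Let `A` be a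
complex abelian variety (e.g. `A = Y^m` with `Y` simple of type IV, or anything isogenous to it), `h ∈ B¹(A) ⊗ ℂ` with `Q_h`
non-degenerate, and suppose THE CENTRE OF `End⁰(A)` IS THE CM FIELD `E = ℚ(ψ)`: `ψ ∈ End(A)` central with `R(ψ) = 0`
(`R` monic irreducible over `ℚ`); its Rosati image `ψ' ∈ End(A)` (`Q_h(ψ^* x, y) = Q_h(x, ψ'^* y)`) with `N'ψ' ∈ ℤ[ψ]`
for some `N' ≠ 0` (`ψ† ∈ E`) and `ψ' ≠ ψ` (`†` is complex conjugation on `E`, non-trivial: `E` is CM, not totally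
real); and every `g ∈ End(A)` commuting with `End(A)` has `N g ∈ ℤ[ψ]` for some `N ≠ 0` (`hZ`: «`Z(End⁰(A)) = E`»).
Then for EVERY `φ ∈ End(A)` with `P(φ) = 0` (`P` monic irreducible of degree `e`, `e · 2m = 2 dim A`, `m ≠ 0`):
`W_F ⊗ ℂ ≤ 𝒟ᵐ ⊗ ℂ` IFF the multiplicities of `σ` for `ψ^*` and `ψ'^*` on every `V_ρ` agree («`θ = 0`»).  The bicommutant
`E'' = End⁰(A) ⊗ ℂ` supplies §1's semisimple adjoint-stable algebra (`bicommutant_typeFour_data`).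
[cite: MoonenZarhin1998WeilClasses, §1 Criterion (2), cases «Y is of Type 4, d = 1, m = 1 and F ⊄ E₀» and «Y is of Type 4 with d ≥ 2 or m ≥ 2 and the map θ … is non-zero», with the proof (chunk p0003 L59–L106)]
[cite: Milne1999LefschetzClasses, §1 pp. 642–644, §2 pp. 646–651, Thm. 3.2, Cor. 4.5] -/
theorem weilClassesField_le_divisorClassesSpan_iff_forall_finrank_eq_of_CMCentre_End (hPm : P.Monic) (hPe : P.natDegree = e)
    (hPirr : Irreducible (P.map (Int.castRingHom ℚ)))
    (hφ : Polynomial.eval₂ (Int.castRingHom (CategoryTheory.End A)) (φ : CategoryTheory.End A) P = 0)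
    (her : e * (2 * m) = 2 * A.dim) (hm : m ≠ 0) (hh : h ∈ hodgeClassSpan A.dim A.X 1)
    (hnd : ∀ x : complexBetti A.X 1, (∀ y, polarizationPairingOne A.X h (A.dim - 1) x y = 0) → x = 0)
    (hψ : ∀ χ : A ⟶ A, ψ ≫ χ = χ ≫ ψ) (hRm : R.Monic) (hRirr : Irreducible (R.map (Int.castRingHom ℚ)))
    (hψR : Polynomial.eval₂ (Int.castRingHom (CategoryTheory.End A)) (ψ : CategoryTheory.End A) R = 0)
    (hadj : ∀ x y : complexBetti A.X 1, polarizationPairingOne A.X h (A.dim - 1) (pullbackOne A ψ x) y =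
      polarizationPairingOne A.X h (A.dim - 1) x (pullbackOne A ψ' y))
    (hψ'E : ∃ N : ℤ, N ≠ 0 ∧ End.of (N • ψ') ∈ Subring.closure {End.of ψ}) (hne : ψ' ≠ ψ)
    (hZ : ∀ g : A ⟶ A, (∀ χ : A ⟶ A, g ≫ χ = χ ≫ g) →
      ∃ N : ℤ, N ≠ 0 ∧ End.of (N • g) ∈ Subring.closure {End.of ψ}) :
    weilClassesField A φ P (2 * m) ≤ divisorClassesSpan A.X A.dim m ↔
      ∀ ρ : ℂ, Polynomial.eval₂ (Int.castRingHom ℂ) ρ P = 0 → ∀ σ : ℂ,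
        Module.finrank ℂ ↥((pullbackOne A φ).eigenspace ρ ⊓ (pullbackOne A ψ).eigenspace σ) =
          Module.finrank ℂ ↥((pullbackOne A φ).eigenspace ρ ⊓ (pullbackOne A ψ').eigenspace σ) := by
  haveI : IsSemisimpleRing (bicommutant A) := isSemisimpleRing_bicommutant A
  obtain ⟨h𝔅, h𝔅adj, hψ𝔅, hψc, hZ', r, b, hb, hspan⟩ := bicommutant_typeFour_data hh hnd hψ hRm hRirr hψR hZ
  exact weilClassesField_le_divisorClassesSpan_iff_forall_finrank_eq_of_semisimple hPm hPe hPirr hφ her hm hh hnd h𝔅 h𝔅adj hψ𝔅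
    hψc (pullbackOne_mem_centralizerAlgebra_of_central' hψ) hRm hRirr hψR
    (pullbackOne_mem_adjoin_singleton_of_exists_zsmul_mem_closure_singleton hψ'E) hadj
    (eigenspace_inf_eigenspace_eq_bot_of_ne_of_exists_zsmul_mem_closure_singleton hRm hRirr hψR hψ'E hne) hZ' hb hspan
    (pullbackOne_mem_bicommutant φ)

/-- **… «ALL NON-ZERO CLASSES EXCEPTIONAL ⟺ `θ ≠ 0`», TYPE 4 FOR EVERY `d` AND `m`, FROM `End(X)`.**
[cite: MoonenZarhin1998WeilClasses, §1 Criterion (2), cases «Type 4» and their proof (chunk p0003 L59–L106)]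
[cite: Milne1999LefschetzClasses, §1 pp. 642–644, Thm. 3.2, Cor. 4.5] -/
theorem weilClassesField_inf_divisorClassesSpan_eq_bot_iff_exists_finrank_ne_of_CMCentre_End (hPm : P.Monic)
    (hPe : P.natDegree = e) (hPirr : Irreducible (P.map (Int.castRingHom ℚ)))
    (hφ : Polynomial.eval₂ (Int.castRingHom (CategoryTheory.End A)) (φ : CategoryTheory.End A) P = 0)
    (her : e * (2 * m) = 2 * A.dim) (hm : m ≠ 0) (hh : h ∈ hodgeClassSpan A.dim A.X 1)
    (hnd : ∀ x : complexBetti A.X 1, (∀ y, polarizationPairingOne A.X h (A.dim - 1) x y = 0) → x = 0)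
    (hψ : ∀ χ : A ⟶ A, ψ ≫ χ = χ ≫ ψ) (hRm : R.Monic) (hRirr : Irreducible (R.map (Int.castRingHom ℚ)))
    (hψR : Polynomial.eval₂ (Int.castRingHom (CategoryTheory.End A)) (ψ : CategoryTheory.End A) R = 0)
    (hadj : ∀ x y : complexBetti A.X 1, polarizationPairingOne A.X h (A.dim - 1) (pullbackOne A ψ x) y =
      polarizationPairingOne A.X h (A.dim - 1) x (pullbackOne A ψ' y))
    (hψ'E : ∃ N : ℤ, N ≠ 0 ∧ End.of (N • ψ') ∈ Subring.closure {End.of ψ}) (hne : ψ' ≠ ψ)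
    (hZ : ∀ g : A ⟶ A, (∀ χ : A ⟶ A, g ≫ χ = χ ≫ g) →
      ∃ N : ℤ, N ≠ 0 ∧ End.of (N • g) ∈ Subring.closure {End.of ψ}) :
    weilClassesField A φ P (2 * m) ⊓ divisorClassesSpan A.X A.dim m = ⊥ ↔
      ∃ ρ σ : ℂ, Polynomial.eval₂ (Int.castRingHom ℂ) ρ P = 0 ∧
        Module.finrank ℂ ↥((pullbackOne A φ).eigenspace ρ ⊓ (pullbackOne A ψ).eigenspace σ) ≠
          Module.finrank ℂ ↥((pullbackOne A φ).eigenspace ρ ⊓ (pullbackOne A ψ').eigenspace σ) := by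
  haveI : IsSemisimpleRing (bicommutant A) := isSemisimpleRing_bicommutant A
  obtain ⟨h𝔅, h𝔅adj, hψ𝔅, hψc, hZ', r, b, hb, hspan⟩ := bicommutant_typeFour_data hh hnd hψ hRm hRirr hψR hZ
  exact weilClassesField_inf_divisorClassesSpan_eq_bot_iff_exists_finrank_ne_of_semisimple hPm hPe hPirr hφ her hm hh hnd h𝔅
    h𝔅adj hψ𝔅 hψc (pullbackOne_mem_centralizerAlgebra_of_central' hψ) hRm hRirr hψR
    (pullbackOne_mem_adjoin_singleton_of_exists_zsmul_mem_closure_singleton hψ'E) hadj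
    (eigenspace_inf_eigenspace_eq_bot_of_ne_of_exists_zsmul_mem_closure_singleton hRm hRirr hψR hψ'E hne) hZ' hb hspan
    (pullbackOne_mem_bicommutant φ)

/-- **THE DICHOTOMY, TYPE 4 FOR EVERY `d` AND `m`, FROM `End(X)`**: «either all classes in `W_F` are decomposable, or all
non-zero classes in `W_F` are exceptional». [cite: MoonenZarhin1998WeilClasses, §1 Criterion (2) (chunk p0003 L59–L67)] -/
theorem weilClassesField_le_or_inf_divisorClassesSpan_eq_bot_of_CMCentre_End (hPm : P.Monic) (hPe : P.natDegree = e)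
    (hPirr : Irreducible (P.map (Int.castRingHom ℚ)))
    (hφ : Polynomial.eval₂ (Int.castRingHom (CategoryTheory.End A)) (φ : CategoryTheory.End A) P = 0)
    (her : e * (2 * m) = 2 * A.dim) (hm : m ≠ 0) (hh : h ∈ hodgeClassSpan A.dim A.X 1)
    (hnd : ∀ x : complexBetti A.X 1, (∀ y, polarizationPairingOne A.X h (A.dim - 1) x y = 0) → x = 0)
    (hψ : ∀ χ : A ⟶ A, ψ ≫ χ = χ ≫ ψ) (hRm : R.Monic) (hRirr : Irreducible (R.map (Int.castRingHom ℚ)))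
    (hψR : Polynomial.eval₂ (Int.castRingHom (CategoryTheory.End A)) (ψ : CategoryTheory.End A) R = 0)
    (hadj : ∀ x y : complexBetti A.X 1, polarizationPairingOne A.X h (A.dim - 1) (pullbackOne A ψ x) y =
      polarizationPairingOne A.X h (A.dim - 1) x (pullbackOne A ψ' y))
    (hψ'E : ∃ N : ℤ, N ≠ 0 ∧ End.of (N • ψ') ∈ Subring.closure {End.of ψ}) (hne : ψ' ≠ ψ)
    (hZ : ∀ g : A ⟶ A, (∀ χ : A ⟶ A, g ≫ χ = χ ≫ g) →
      ∃ N : ℤ, N ≠ 0 ∧ End.of (N • g) ∈ Subring.closure {End.of ψ}) :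
    weilClassesField A φ P (2 * m) ≤ divisorClassesSpan A.X A.dim m ∨
      weilClassesField A φ P (2 * m) ⊓ divisorClassesSpan A.X A.dim m = ⊥ := by
  haveI : IsSemisimpleRing (bicommutant A) := isSemisimpleRing_bicommutant A
  obtain ⟨h𝔅, h𝔅adj, hψ𝔅, hψc, hZ', r, b, hb, hspan⟩ := bicommutant_typeFour_data hh hnd hψ hRm hRirr hψR hZ
  exact weilClassesField_le_or_inf_divisorClassesSpan_eq_bot_of_semisimple hPm hPe hPirr hφ her hm hh hnd h𝔅 h𝔅adj hψ𝔅 hψc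
    (pullbackOne_mem_centralizerAlgebra_of_central' hψ) hRm hRirr hψR
    (pullbackOne_mem_adjoin_singleton_of_exists_zsmul_mem_closure_singleton hψ'E) hadj
    (eigenspace_inf_eigenspace_eq_bot_of_ne_of_exists_zsmul_mem_closure_singleton hRm hRirr hψR hψ'E hne) hZ' hb hspan
    (pullbackOne_mem_bicommutant φ)

/-- **… and in the decomposable case `W_F` is ALGEBRAIC** (Lefschetz (1,1) and products).
[cite: MoonenZarhin1998WeilClasses, Introduction (chunk p0001 L10–L18) and §1 Criterion (2) (chunk p0003 L59–L80)]
[cite: VoisinHodgeI2002, Thm. 11.30] -/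
theorem weilClassesField_le_algebraicClasses_of_CMCentre_End_of_forall_finrank_eq (hPm : P.Monic) (hPe : P.natDegree = e)
    (hPirr : Irreducible (P.map (Int.castRingHom ℚ)))
    (hφ : Polynomial.eval₂ (Int.castRingHom (CategoryTheory.End A)) (φ : CategoryTheory.End A) P = 0)
    (her : e * (2 * m) = 2 * A.dim) (hm : m ≠ 0) (hh : h ∈ hodgeClassSpan A.dim A.X 1)
    (hnd : ∀ x : complexBetti A.X 1, (∀ y, polarizationPairingOne A.X h (A.dim - 1) x y = 0) → x = 0)
    (hψ : ∀ χ : A ⟶ A, ψ ≫ χ = χ ≫ ψ) (hRm : R.Monic) (hRirr : Irreducible (R.map (Int.castRingHom ℚ)))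
    (hψR : Polynomial.eval₂ (Int.castRingHom (CategoryTheory.End A)) (ψ : CategoryTheory.End A) R = 0)
    (hadj : ∀ x y : complexBetti A.X 1, polarizationPairingOne A.X h (A.dim - 1) (pullbackOne A ψ x) y =
      polarizationPairingOne A.X h (A.dim - 1) x (pullbackOne A ψ' y))
    (hψ'E : ∃ N : ℤ, N ≠ 0 ∧ End.of (N • ψ') ∈ Subring.closure {End.of ψ}) (hne : ψ' ≠ ψ)
    (hZ : ∀ g : A ⟶ A, (∀ χ : A ⟶ A, g ≫ χ = χ ≫ g) →
      ∃ N : ℤ, N ≠ 0 ∧ End.of (N • g) ∈ Subring.closure {End.of ψ})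
    (hbal : ∀ ρ : ℂ, Polynomial.eval₂ (Int.castRingHom ℂ) ρ P = 0 → ∀ σ : ℂ,
      Module.finrank ℂ ↥((pullbackOne A φ).eigenspace ρ ⊓ (pullbackOne A ψ).eigenspace σ) =
        Module.finrank ℂ ↥((pullbackOne A φ).eigenspace ρ ⊓ (pullbackOne A ψ').eigenspace σ)) :
    weilClassesField A φ P (2 * m) ≤ algebraicClasses A.X m := by
  haveI : IsSemisimpleRing (bicommutant A) := isSemisimpleRing_bicommutant A
  obtain ⟨h𝔅, h𝔅adj, hψ𝔅, hψc, hZ', r, b, hb, hspan⟩ := bicommutant_typeFour_data hh hnd hψ hRm hRirr hψR hZ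
  exact weilClassesField_le_algebraicClasses_of_semisimple_of_forall_finrank_eq hPm hPe hPirr hφ her hm hh hnd h𝔅 h𝔅adj hψ𝔅 hψc
    hRm hRirr hψR (pullbackOne_mem_adjoin_singleton_of_exists_zsmul_mem_closure_singleton hψ'E) hadj
    (eigenspace_inf_eigenspace_eq_bot_of_ne_of_exists_zsmul_mem_closure_singleton hRm hRirr hψR hψ'E hne) hZ' hb hspan
    (pullbackOne_mem_bicommutant φ) hbal

end EndLevel

end Literature.AlgebraicGeometry.HodgeTheory

end
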